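import Literature.MathematicalPhysics.QuantumFieldTheory.LatticeYangMillsUniformLogSobolev
import Summits.Ventures.YMGap.Thresholds.RegionHessianCalculus
import Summits.Ventures.YMGap.Thresholds.SharpMassGap

/-!
# Venture YMGap — Theorem C, consequence III: DLR uniqueness and the cell's target type
# `ImprovedThreshold d N (1/(8d))`, conditionally on three named printed facts

HONEST FRAMING: venture file (cell `pub-ymgap`, track (a), item A2, uniqueness leg). KERNEL-CHECKED
here: (i) the regional Hessian hypothesis of the Bakry–Émery fact holds with `Λ₀ = 4d` for every
finite edge set and every exterior configuration (`regionWilsonHessianBound_four_d`, from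
`RegionHessian.abs_region_second_variation_le_four_d` — Theorem C with frozen exterior); (ii) the
composition and threshold arithmetic; (iii) existence of DLR states (tree theorems). CONDITIONAL on
THREE NAMED printed facts, none proved in the tree:
`bakryEmery_kernelLogSobolev` (Bakry–Émery criterion for the DLR kernels, Hessian constant as a
parameter), `stroockZegarlinski_uniqueness` (Stroock–Zegarlinski CMP 144 (1992) Thm 1.2/3.2: uniform
log-Sobolev ⇒ unique Gibbs state) and `shenZhuZhu_massGap_transfer` (SZZ Cor. 4.11 with the Hessian
constant as a parameter): `improvedThreshold_sharp` — for `d ≥ 3`, `N ≥ 2`,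
`ImprovedThreshold d N (1/(8d))`, i.e. `1/(16(d-1)) < 1/(8d)` and for every 't Hooft coupling
`|β| < 1/(8d)` the `SU(N)` Wilson specification at tree coupling `Nβ` has a UNIQUE DLR state which
clusters exponentially in SZZ's form (`MassGapBelow d N (1/(8d))`, all `N ≥ 2`, N-uniform). In
`d = 4`: `|β| < 1/32` vs the printed `1/48` (`SU(2)`: `β_W < 1/8` vs `1/12`; `SU(3)`: `9/32` vs `3/16`).
This is the cell's track-(a) target TYPE (`StrongCouplingGapShape.ImprovedThreshold`) at class
K-conditional; it is NOT an unconditional theorem, NOT an area law, and makes no claim at physical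
couplings; for `SU(2)`, `SU(3)` in `d = 4` the tree's Dobrushin fronts are higher and the content is
N-uniformity.

Reference: cell files `p2/HESSIAN-SHARP.md` §4, `paper/gap-below-beta0prime.md` §7; D. Bakry,
M. Émery (1985); D. W. Stroock, B. Zegarlinski, CMP 144 (1992) Thm 1.2, 3.2; H. Shen, R. Zhu, X. Zhu,
CMP 400 (2023) Lemma 4.1, Thm 4.2, Cor. 4.11, Rem. 1.3.
-/

noncomputable section

namespace Summit.Ventures.YMGap.HessianSharp

open Literature.MathematicalPhysics.QuantumFieldTheory
open Literature.MathematicalPhysics.QuantumLattice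
open scoped Matrix

variable {d N : ℕ}

local notation "ZdE" => Literature.MathematicalPhysics.QuantumLattice.ZdEdge

/-! ## The kernel theorem discharges the regional Hessian hypothesis with `Λ₀ = 4d` -/

/-- Dictionary: the Literature functional `regionPlaquetteSumAlong E U X` is this venture's
`t ↦ regionRe (zperturb ↑U X t) E` (same plaquette set, same word, same exponential curve). -/
theorem regionPlaquetteSumAlong_eq (E : Finset (ZdE d))
    (U : LGConfig d (Matrix.specialUnitaryGroup (Fin N) ℂ)) (X : ZdE d → Matrix (Fin N) (Fin N) ℂ) :
    regionPlaquetteSumAlong E U X =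
      fun t => regionRe (zperturb (fun e => (U e : Matrix (Fin N) (Fin N) ℂ)) X t) E :=
  rfl

/-- Dictionary: `Σ_{e∈E} Re tr(X_eX_eᴴ)` is this venture's `regionNormSq X E`. -/
theorem sum_re_trace_eq_regionNormSq (X : ZdE d → Matrix (Fin N) (Fin N) ℂ)
    (E : Finset (ZdE d)) : ∑ e ∈ E, (X e * (X e)ᴴ).trace.re = regionNormSq X E :=
  rfl

variable (d N) in
/-- **Theorem C with frozen exterior, in the Literature format (kernel-checked):** the regional
Hessian hypothesis of the Bakry–Émery fact holds with `Λ₀ = 4d`: for every finite edge set `E`,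
every `U ∈ SU(N)^{edges}` and every `X ∈ 𝔰𝔲(N)^{edges}` vanishing off `E`,
`|d²/dt²|₀ Σ_{p∩E≠∅} Re tr hol_p(e^{tX}U)| ≤ 4d Σ_{e∈E} tr(X_eX_e^*)`. -/
theorem regionWilsonHessianBound_four_d : RegionWilsonHessianBound d N (4 * d) := by
  intro E U X hX _ hXE
  rw [regionPlaquetteSumAlong_eq, sum_re_trace_eq_regionNormSq]
  exact abs_region_second_variation_le_four_d _ X
    (fun e => (Matrix.mem_specialUnitaryGroup_iff.1 (U e).2).1) hX E hXE

/-- In particular the regional form of SZZ's own Lemma 4.1 count (`Λ₀ = 8(d-1)`, `d ≥ 2`). -/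
theorem regionWilsonHessianBound_szz (hd : 2 ≤ d) :
    RegionWilsonHessianBound d N (8 * ((d : ℝ) - 1)) :=
  (regionWilsonHessianBound_four_d d N).mono (by
    have : (2 : ℝ) ≤ d := by exact_mod_cast hd
    linarith)

/-! ## Uniform log-Sobolev inequality and uniqueness at the sharp window -/

/-- The sharp Bakry–Émery constant is positive in the sharp window (restated with `2 ≤ N`). -/
theorem sharpConst_pos (hd : 1 ≤ d) (hN : 2 ≤ N) {β : ℝ} (hβ : |β| < sharpThresholdSU d) :
    0 < (N : ℝ) / 2 - N * |β| * (4 * d) := by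
  rw [← sharpBakryEmeryConstSU_eq]
  exact (sharpBakryEmeryConstSU_pos_iff hd (le_trans one_le_two hN) β).2 hβ

/-- **Uniform log-Sobolev inequality for all DLR kernels at `|β| < 1/(8d)`**, conditional on the
Bakry–Émery fact: every kernel `γ_E(· | η)` satisfies `LSI(2/K)` in gradient form with
`K = N/2 - 4dN|β|`, uniformly in `E` and `η`. -/
theorem uniformKernelLogSobolev_sharp (h₁ : bakryEmery_kernelLogSobolev d N) (hd : 1 ≤ d)
    (hN : 2 ≤ N) {β : ℝ} (hβ : |β| < sharpThresholdSU d) :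
    UniformKernelLogSobolev d N β (sharpBakryEmeryConstSU N d β) := by
  have key := h₁ (4 * d) (by positivity) (regionWilsonHessianBound_four_d d N) hN β
    (sharpConst_pos hd hN hβ)
  rwa [← sharpBakryEmeryConstSU_eq] at key

/-- DLR states of the `SU(N)` Wilson specification exist at every coupling (tree theorems:
infinite-volume limit points exist and are DLR). -/
theorem ymGibbsMeasures_nonempty (β : ℝ) :
    (ymGibbsMeasures (d := d) (fundamentalRep (Fin N)) β).Nonempty := by
  haveI : SecondCountableTopology (Matrix (Fin N) (Fin N) ℂ) :=
    inferInstanceAs (SecondCountableTopology (Fin N → Fin N → ℂ))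
  haveI : SecondCountableTopology (Matrix.specialUnitaryGroup (Fin N) ℂ) :=
    Topology.IsEmbedding.subtypeVal.secondCountableTopology
  obtain ⟨ν, hν⟩ := infiniteVolumeLimitPoints_nonempty_holds (d := d) (fundamentalRep (Fin N))
    (continuous_fundamentalRep (Fin N)) β
  exact ⟨ν, mem_ymGibbsMeasures_of_mem_infiniteVolumeLimitPoints_holds (fundamentalRep (Fin N))
    (continuous_fundamentalRep (Fin N)) hν⟩

/-- **DLR uniqueness at `|β| < 1/(8d)`** (`SharpUniqueness d N`), conditional on the Bakry–Émery fact
and the Stroock–Zegarlinski fact: for `d, N ≥ 2` and every `|β| < 1/(8d)` the `SU(N)` Wilson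
specification at tree coupling `Nβ` has exactly one DLR state. -/
theorem sharpUniqueness_of_logSobolev (h₁ : bakryEmery_kernelLogSobolev d N)
    (h₂ : stroockZegarlinski_uniqueness d N) (hd : 2 ≤ d) (hN : 2 ≤ N) : SharpUniqueness d N := by
  intro β hβ
  exact ⟨subsingleton_gibbs_of_regionHessianBound h₁ h₂ hd hN (by positivity)
      (regionWilsonHessianBound_four_d d N) (sharpConst_pos (le_trans one_le_two hd) hN hβ),
    ymGibbsMeasures_nonempty _⟩

/-- Consistency: fed with SZZ's own count `Λ₀ = 8(d-1)`, the two facts give uniqueness in the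
PRINTED window `|β| < 1/(16(d-1))` — a statement the tree proves unconditionally by the Dobrushin
route (`shen_zhu_zhu_holds`). -/
theorem hasUniqueGibbsMeasure_szz_of_logSobolev (h₁ : bakryEmery_kernelLogSobolev d N)
    (h₂ : stroockZegarlinski_uniqueness d N) (hd : 2 ≤ d) (hN : 2 ≤ N) {β : ℝ}
    (hβ : |β| < szzThresholdSU d) :
    Literature.Probability.LatticeModels.HasUniqueGibbsMeasure
      (ymSpecification (d := d) (fundamentalRep (Fin N)) ((N : ℝ) * β)) :=
  sharpUniqueness_of_logSobolev h₁ h₂ hd hN β (hβ.trans_le (szzThresholdSU_le_sharpThresholdSU hd))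

/-! ## The cell's target type at the sharp window -/

/-- **`MassGapBelow d N (1/(8d))`**, conditional on the three named facts: for `d, N ≥ 2` and
every `|β| < 1/(8d)`, DLR uniqueness AND exponential clustering of every DLR state (SZZ form). -/
theorem massGapBelow_sharp (h₁ : bakryEmery_kernelLogSobolev d N)
    (h₂ : stroockZegarlinski_uniqueness d N) (h₃ : shenZhuZhu_massGap_transfer d N) (hd : 2 ≤ d)
    (hN : 2 ≤ N) : MassGapBelow d N (sharpThresholdSU d) :=
  massGapBelow_sharp_of_uniqueness h₃ (sharpUniqueness_of_logSobolev h₁ h₂ hd hN) hd hN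

/-- **The cell's track-(a) target type, at class K-conditional.** For `d ≥ 3`, `N ≥ 2`, assuming the
three named printed facts (Bakry–Émery for kernels; Stroock–Zegarlinski; SZZ Cor. 4.11 transfer):
`ImprovedThreshold d N (1/(8d))` — the threshold `1/(8d)` is strictly larger than Shen–Zhu–Zhu's
`1/(16(d-1))` and the mass gap (`MassGapAt`: unique DLR state + exponential clustering) holds for
every 't Hooft coupling below it. The only model-specific input, the Hessian constant `4d`, is the
kernel theorem `regionWilsonHessianBound_four_d` / `wilsonHessianBound_four_d`. -/
theorem improvedThreshold_sharp (h₁ : bakryEmery_kernelLogSobolev d N)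
    (h₂ : stroockZegarlinski_uniqueness d N) (h₃ : shenZhuZhu_massGap_transfer d N) (hd : 3 ≤ d)
    (hN : 2 ≤ N) : ImprovedThreshold d N (sharpThresholdSU d) :=
  improvedThreshold_sharp_of_uniqueness h₃
    (sharpUniqueness_of_logSobolev h₁ h₂ (le_trans (by norm_num) hd) hN) hd hN

/-- Numbers of record, `d = 4`: conditional on the three facts, `ImprovedThreshold 4 N (1/32)` for
every `N ≥ 2` (printed bar `1/48`); in Wilson units `β_W = N²β`: `SU(2)` `β_W < 1/8`, `SU(3)`
`β_W < 9/32` (`sharpThresholdSU_wilson_values`). -/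
theorem improvedThreshold_dim4 (h₁ : bakryEmery_kernelLogSobolev 4 N)
    (h₂ : stroockZegarlinski_uniqueness 4 N) (h₃ : shenZhuZhu_massGap_transfer 4 N) (hN : 2 ≤ N) :
    ImprovedThreshold 4 N (1 / 32) := by
  have := improvedThreshold_sharp h₁ h₂ h₃ (by norm_num) hN
  rwa [sharpThresholdSU_values.1] at this

end Summit.Ventures.YMGap.HessianSharp
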